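import Mathlib
import Literature.MathematicalPhysics.QuantumLattice.FermiRG.Salmhofer1998Lemma4Bounds
import Literature.MathematicalPhysics.QuantumLattice.FermiRG.Salmhofer1998DotCovarianceProof
import HarnessLib

/-!
# Salmhofer, *Continuous renormalization for fermions and Fermi liquid theory* (CMP 194 (1998) 249):
# Proposition 5 — the power-counting inputs (4.14)/(4.15) of Theorem 1 hold for the many-fermion model in
# `d = 1` in the thermodynamic limit — PROVED from the tree's Lemma 4 and Lemma 5

Theorem-only companion of the `gate-hubbard-kl` statements-first wave (DAG row `Sal98.P5`, licence F-088,
wave-optional; t7 g8).  Source: M. Salmhofer, Commun. Math. Phys. **194** (1998) 249–295,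
arXiv:cond-mat/9706188 [Salmhofer1998], Proposition 5, render chunk p0021 L7–14: "The hypotheses of Theorem
(opoco) [= Theorem 1, (4.14) `∫_{Λ*} dk |Ĉ_t(k)| ≤ Δ₁ e^{-t}` and (4.15) `‖Ċ_t‖ ≤ Δ₂ e^{t}`, p.15 L12–24] are
satisfied for the many-fermion model in `d = 1` in the thermodynamic limit.  Proof. (4.14) follows from (5.21).
(4.15) follows from Lemma 5."

The printed two-line proof, verbatim: (5.21) `∫ |D̂_t| ≤ 8J₁ε_t = (8J₁ε₀) e^{-t}` is the tree's
`Salmhofer1998.exists_display521` (Lemma 4, `Salmhofer1998Lemma4Bounds.lean`, t7 g6) and Lemma 5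
`‖Ḋ_t‖ ≤ Δ₂ e^{td} = Δ₂ e^{t}` at `d = 1` is the tree's `Salmhofer1998.DotCovarianceL1Bound_holds`
(`Salmhofer1998DotCovarianceProof.lean`, t7 g5; its hypothesis `k₀ > d = 1` is part of the §2.3 class,
`ModelData.Hyp.two_le_k0`).  "In the thermodynamic limit": both displays are the infinite-volume objects of §5.4
(F7c `covL1Momentum`, `dotCovL1`), which is how (4.14)/(4.15) are read there (Remark 8, p.20 L156–161: the
finite-volume version needs the Fermi surface to avoid the momentum lattice).  No new definition, no named fact
(licence F-088 is closed by a theorem); nothing about the Hubbard model is asserted.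
-/

noncomputable section

open MeasureTheory
open scoped ENNReal

namespace Literature.MathematicalPhysics.QuantumLattice.FermiRG

namespace Salmhofer1998

/-- **Proposition 5 (p.21 L7–14)**: for the many-fermion model of the §2.3 class in `d = 1` (cutoff `χ₁` as in
§4.1), the hypotheses (4.14) and (4.15) of Theorem 1 hold in the thermodynamic limit — there are `Δ₁, Δ₂ > 0`
(independent of `β`) with `∫_{ℝ×𝓑} d²p/(2π)² |D̂_t(p)| ≤ Δ₁ e^{-t}` and `‖Ḋ_t‖ ≤ Δ₂ e^{t}` for all `β` in the
standing window `βε₀ ≥ 6` and all `t ≥ 0`; `Δ₁ = 8J₁ε₀` from (5.21) and `Δ₂` from Lemma 5, exactly as the printed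
proof says. `Sal98.P5` · Salmhofer 1998 Proposition 5 · p.21 L7–14.
[cite: Salmhofer1998, Proposition 5 (p.21 L7–14)] -/
theorem proposition5_oneDim_powerCountingInputs (M : ModelData 1) (hM : M.Hyp) {χ₁ : ℝ → ℝ}
    (hχ : IsCutoff χ₁) :
    ∃ Δ₁ Δ₂ : ℝ, 0 < Δ₁ ∧ 0 < Δ₂ ∧
      ∀ β : ℝ, 0 < β → 6 ≤ β * M.eps0 → ∀ t : ℝ, 0 ≤ t →
        covL1Momentum M χ₁ β t ≤ ENNReal.ofReal (Δ₁ * Real.exp (-t)) ∧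
        dotCovL1 M χ₁ β t ≤ ENNReal.ofReal (Δ₂ * Real.exp t) := by
  obtain ⟨J₁, hJ₁, -, h521⟩ := exists_display521 hM hχ
  have hk : 1 < M.k0 := lt_of_lt_of_le one_lt_two hM.two_le_k0
  obtain ⟨Δ₂, hΔ₂, hL5⟩ := DotCovarianceL1Bound_holds 1 M hM hk χ₁ hχ
  refine ⟨8 * J₁ * M.eps0, Δ₂, by have := hM.eps0_pos; positivity, hΔ₂, ?_⟩
  intro β hβ hβε t ht
  refine ⟨?_, ?_⟩
  · have h := h521 β hβ t ht
    unfold Display521 epsT at h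
    simpa [mul_assoc] using h
  · simpa using hL5 β hβ hβε t ht

end Salmhofer1998

end Literature.MathematicalPhysics.QuantumLattice.FermiRG
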